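import Mathlib.Analysis.SpecialFunctions.Pow.Real
import Mathlib.Analysis.SpecialFunctions.Sqrt
import Literature.Claims.NS.Nadirashvili2026

/-!
# C129 `Nadirashvili2026` — refutation of Step 10 `Step_subsol` = display (5.18), print p.36

D-0090 NS-CLAIMS (cell ns-claims, row C129; N. Nadirashvili, *Navier–Stokes Equations in Complex
Space*, arXiv:2606.02811 v4, PDF page = printed page). Skeleton
`Literature.Claims.NS.Nadirashvili2026` (ns-claims-typist-7 g3, p493920). Kernel core:
ns-claims-refuter-5 g0 (`Kill518-general-b.lean`, 2026-08-27); retargeted onto the landed decl by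
ns-claims-refuter-5 g2.

LOCATOR. `Literature.Claims.NS.Nadirashvili2026.Step_subsol` = p.36 l.36–40 [TeX 1582–1585], display
(5.18): «From inequality (5.12) follows that for any C, b > 0 there is K > 0, K = K(C, b) such that
for k > K function y_k(x) is a subsolution of a differential inequality on (0, δ), δ = 1/k^{3/2},
y″_k > (b/x^{3/2}) y″_k (y′_k)^{1/2} + (4/x) y′_k + C x³ (y′_k)^{1/2}», with the printed comparison
function y_k(x) = (k/120) x⁵ + x^{41/8} (p.35), y′_k = `dyk`, y″_k = `ddyk`.

CLASS. false lemma (countermodel, functions grain) — FALSE for EVERY b > 0 and every C ≥ 0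
(`not_step_subsol_at`), a fortiori as quantified (`not_Step_subsol`).

WITNESS. The k-terms of y″_k and (4/x) y′_k cancel exactly (x⁵ solves y″ = 4y′/x), leaving the
margin y″_k − (4/x) y′_k = (41/64) x^{25/8}, while (b/x^{3/2}) y″_k √(y′_k) ≥ (b k^{3/2}/(6√24))
x^{7/2} dominates it on all of (0, k^{−3/2}) outside a k^{−4}-neighbourhood of 0. Exact rational
family: pick c ∈ ℕ with c ≥ 1/b + 1 (so bc ≥ 1, c ≥ 1), j ∈ ℕ with j > max(K + 1, 3c²),
k = 24 j² > K, x = (c/j)⁸ ∈ (0, k^{−3/2}); with t = c/j: y′_k(x) = c² t³⁰ + (41/8) t³³,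
y″_k(x) = 4c² t²² + (1353/64) t²⁵, (4/x) y′_k = 4c² t²² + (41/2) t²⁵, √(y′_k) ≥ c t¹⁵, so the
right side of (5.18) is ≥ 4c² t²² + (41/2) t²⁵ + 4bc³ t²⁵ > y″_k(x).

REPAIRED STATEMENT: none in the printed family — for y = (k/120)x⁵ + x^q, δ = k^{−a}, (5.18) on
(0, δ) needs q ∈ (5, 11/2) and a(11/2 − q) ≥ 3/2, while (5.13) p.35 at its equality case (which
defines t₂, (5.14)) needs a(7 − q) ≤ 2 — incompatible; the referee's charitable (5.18)′
(∃ δ = δ(k,b,C) ≍ k^{−4}) is true but then (5.19) fails at that δ, leaving the residue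
p.37 l.18–19 (unfilled gap; RETYPE.md).

Filed under interim convention (b) by the paired salvage prover, verbatim.

WHAT THIS IS NOT: not a claim about NS regularity or blow-up; not a claim about any author beyond
the typed locator.
-/

set_option linter.dupNamespace false

open Real Set

namespace Summit.NavierStokesRegularity.NavierStokesRegularity.Theorems.Nadirashvili2026

open Literature.Claims.NS.Nadirashvili2026

/-- `(t⁸)^(p/8) = t^p` for `t > 0`, `p ∈ ℕ`: the substitution `x = t⁸` turns every printed exponent
`41/8, 33/8, 25/8, 3/2` into an integer power. [folklore] -/
theorem rpow_pow_eight {t : ℝ} (ht : 0 < t) (p : ℕ) : (t ^ 8) ^ ((p : ℝ) / 8) = t ^ p := by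
  rw [← Real.rpow_natCast t 8, ← Real.rpow_mul ht.le]
  have : ((8 : ℕ) : ℝ) * ((p : ℝ) / 8) = (p : ℝ) := by push_cast; ring
  rw [this, Real.rpow_natCast]

/-- `(t⁸)^(33/8) = t³³`. [folklore] -/
theorem pow_eight_rpow_33 {t : ℝ} (ht : 0 < t) : (t ^ 8) ^ (33 / 8 : ℝ) = t ^ 33 := by
  have := rpow_pow_eight ht 33; norm_num at this; exact this

/-- `(t⁸)^(25/8) = t²⁵`. [folklore] -/
theorem pow_eight_rpow_25 {t : ℝ} (ht : 0 < t) : (t ^ 8) ^ (25 / 8 : ℝ) = t ^ 25 := by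
  have := rpow_pow_eight ht 25; norm_num at this; exact this

/-- `(t⁸)^(3/2) = t¹²`. [folklore] -/
theorem pow_eight_rpow_three_halves {t : ℝ} (ht : 0 < t) : (t ^ 8) ^ (3 / 2 : ℝ) = t ^ 12 := by
  have := rpow_pow_eight ht 12; norm_num at this; exact this

/-- The printed `y′_k` at the witness `k = 24c²/t²`, `x = t⁸`: `y′_k(x) = c² t³⁰ + (41/8) t³³`.
[cite: Nadirashvili2026, §5 p.35] -/
theorem dyk_witness {c t : ℝ} (ht : 0 < t) :
    dyk (24 * c ^ 2 / t ^ 2) (t ^ 8) = c ^ 2 * t ^ 30 + 41 / 8 * t ^ 33 := by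
  unfold dyk; rw [pow_eight_rpow_33 ht]; field_simp

/-- The printed `y″_k` at the witness `k = 24c²/t²`, `x = t⁸`: `y″_k(x) = 4c² t²² + (1353/64) t²⁵`.
[cite: Nadirashvili2026, §5 p.35] -/
theorem ddyk_witness {c t : ℝ} (ht : 0 < t) :
    ddyk (24 * c ^ 2 / t ^ 2) (t ^ 8) = 4 * c ^ 2 * t ^ 22 + 1353 / 64 * t ^ 25 := by
  unfold ddyk; rw [pow_eight_rpow_25 ht]; field_simp; ring

/-- `√(y′_k(x)) ≥ c t¹⁵` at the witness (drop the `x^{33/8}` term).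
[cite: Nadirashvili2026, §5 p.35] -/
theorem sqrt_dyk_witness_ge {c t : ℝ} (ht : 0 < t) :
    c * t ^ 15 ≤ Real.sqrt (dyk (24 * c ^ 2 / t ^ 2) (t ^ 8)) := by
  rw [dyk_witness ht]
  apply Real.le_sqrt_of_sq_le
  nlinarith [pow_pos ht 33, pow_pos ht 30, sq_nonneg c]

/-- Arithmetic heart of the countermodel: for `t > 0`, `b > 0`, `c ≥ 1`, `bc ≥ 1`, `C ≥ 0` and any
`s ≥ c t¹⁵` (standing for `√(y′_k)`), the right side of (5.18) at the witness is NOT below the left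
side: `4bc³ t²⁵ ≥ 4 t²⁵ > (41/64) t²⁵ = y″_k − (4/x) y′_k`. [cite: Nadirashvili2026, (5.18) p.36] -/
theorem core {t b c C s : ℝ} (ht : 0 < t) (hb : 0 < b) (hc : 1 ≤ c) (hbc : 1 ≤ b * c)
    (hC : 0 ≤ C) (hs : c * t ^ 15 ≤ s) :
    ¬ (b / (t ^ 8) ^ (3 / 2 : ℝ) * (4 * c ^ 2 * t ^ 22 + 1353 / 64 * t ^ 25) * s
          + 4 / t ^ 8 * (c ^ 2 * t ^ 30 + 41 / 8 * t ^ 33) + C * (t ^ 8) ^ 3 * s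
        < 4 * c ^ 2 * t ^ 22 + 1353 / 64 * t ^ 25) := by
  rw [pow_eight_rpow_three_halves ht]
  have hc0 : 0 < c := by linarith
  have hs0 : 0 ≤ s := le_trans (by positivity) hs
  have h1 : 4 * b * c ^ 3 * t ^ 25
      ≤ b / t ^ 12 * (4 * c ^ 2 * t ^ 22 + 1353 / 64 * t ^ 25) * s := by
    have e : b / t ^ 12 * (4 * c ^ 2 * t ^ 22) * (c * t ^ 15) = 4 * b * c ^ 3 * t ^ 25 := by
      field_simp
    rw [← e]
    apply mul_le_mul _ hs (by positivity) (by positivity)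
    apply mul_le_mul_of_nonneg_left _ (by positivity)
    nlinarith [pow_pos ht 25]
  have h2 : 4 / t ^ 8 * (c ^ 2 * t ^ 30 + 41 / 8 * t ^ 33)
      = 4 * c ^ 2 * t ^ 22 + 41 / 2 * t ^ 25 := by
    field_simp
    ring
  have h3 : 0 ≤ C * (t ^ 8) ^ 3 * s := by positivity
  have h4 : 0 < t ^ 25 := pow_pos ht 25
  have h5 : 1 ≤ b * c ^ 3 := by nlinarith
  intro hlt
  rw [h2] at hlt
  nlinarith

/-- Window membership, multiplicative form: `(24 j²)^{3/2} c⁸ < j⁸` when `c ≥ 1`, `j ≥ 3c²`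
(`√24 < 49/10`, `(49/10)³ < 118`, `118 c¹⁰ ≤ 243 c¹⁰ ≤ j⁵`). [folklore] -/
theorem window_aux {j c : ℝ} (hc : 1 ≤ c) (hj : 3 * c ^ 2 ≤ j) :
    ((24 : ℝ) * j ^ 2) ^ (3 / 2 : ℝ) * c ^ 8 < j ^ 8 := by
  have hc0 : 0 < c := by linarith
  have hj0 : 0 < j := by nlinarith
  have e1 : (24 : ℝ) * j ^ 2 = (Real.sqrt 24 * j) ^ 2 := by
    rw [mul_pow, Real.sq_sqrt (by norm_num)]
  rw [e1, ← Real.rpow_natCast _ 2, ← Real.rpow_mul (by positivity)]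
  norm_num
  have hs : Real.sqrt 24 < 49 / 10 := by
    rw [Real.sqrt_lt' (by norm_num)]; norm_num
  have hj5 : (243 : ℝ) * c ^ 10 ≤ j ^ 5 := by
    have h35 : (3 * c ^ 2) ^ 5 ≤ j ^ 5 := by gcongr
    nlinarith [h35]
  have hc8 : c ^ 8 ≤ c ^ 10 := by
    have : 1 ≤ c ^ 2 := by nlinarith
    nlinarith [pow_pos hc0 8]
  calc (Real.sqrt 24 * j) ^ 3 * c ^ 8 = (Real.sqrt 24) ^ 3 * (j ^ 3 * c ^ 8) := by ring
    _ < (49 / 10) ^ 3 * (j ^ 3 * c ^ 8) := by gcongr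
    _ ≤ 118 * (j ^ 3 * c ^ 10) := by nlinarith [pow_pos hj0 3, pow_pos hc0 8, pow_pos hc0 10]
    _ ≤ j ^ 3 * j ^ 5 := by
        have h118 : (118 : ℝ) * c ^ 10 ≤ j ^ 5 := by nlinarith [pow_pos hc0 10]
        nlinarith [mul_le_mul_of_nonneg_left h118 (pow_pos hj0 3).le]
    _ = j ^ 8 := by ring

/-- Window membership: the witness point `x = (c/j)⁸` lies in `(0, δ)`, `δ = k^{−3/2}`, `k = 24 j²`,
whenever `c ≥ 1` and `j ≥ 3c²`. [cite: Nadirashvili2026, (5.18) p.36] -/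
theorem witness_mem_window {j c : ℝ} (hc : 1 ≤ c) (hj : 3 * c ^ 2 ≤ j) :
    (c / j) ^ 8 ∈ Ioo 0 (((24 : ℝ) * j ^ 2) ^ (-(3 / 2 : ℝ))) := by
  have hc0 : 0 < c := by linarith
  have hj0 : 0 < j := by nlinarith
  have hpos : 0 < ((24 : ℝ) * j ^ 2) ^ (3 / 2 : ℝ) := by positivity
  refine ⟨by positivity, ?_⟩
  rw [Real.rpow_neg (by positivity), div_pow, div_lt_iff₀ (by positivity),
    ← div_eq_inv_mul, lt_div_iff₀ hpos, mul_comm]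
  exact window_aux hc hj

/-- **(5.18) is false at EVERY fixed `b > 0`, `C ≥ 0`** (parametrised grain of `Step_subsol`): no
threshold `K` makes the printed `y_k` a subsolution on `(0, k^{−3/2})` for all `k > K` — for
`k = 24 j²`, `x = (c/j)⁸` (`c ≥ 1/b + 1`, `j > max (K+1) (3c²)` natural) the inequality fails.
[cite: Nadirashvili2026, (5.18) p.36] -/
theorem not_step_subsol_at {b C : ℝ} (hb : 0 < b) (hC : 0 ≤ C) :
    ¬ ∃ K : ℝ, 0 < K ∧ ∀ k : ℝ, K < k → ∀ x ∈ Ioo 0 (k ^ (-(3 / 2 : ℝ))),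
      b / x ^ (3 / 2 : ℝ) * ddyk k x * Real.sqrt (dyk k x) + 4 / x * dyk k x +
          C * x ^ 3 * Real.sqrt (dyk k x) < ddyk k x := by
  rintro ⟨K, -, hK⟩
  obtain ⟨nc, hnc⟩ := exists_nat_gt (1 / b + 1)
  set c : ℝ := (nc : ℝ) with hcdef
  have hc1 : 1 ≤ c := by
    have : 0 < 1 / b := by positivity
    linarith
  have hbc : 1 ≤ b * c := by
    have h1 : 1 / b < c := by linarith
    have := (div_lt_iff₀ hb).mp h1
    linarith [this]
  obtain ⟨nj, hnj⟩ := exists_nat_gt (max (K + 1) (3 * c ^ 2))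
  set j : ℝ := (nj : ℝ) with hjdef
  have hj3 : 3 * c ^ 2 ≤ j := le_of_lt (lt_of_le_of_lt (le_max_right _ _) hnj)
  have hjK : K + 1 < j := lt_of_le_of_lt (le_max_left _ _) hnj
  have hc0 : 0 < c := by linarith
  have hj0 : 0 < j := by nlinarith
  have hj1 : 1 ≤ j := by nlinarith
  set t : ℝ := c / j with htdef
  have ht : 0 < t := by positivity
  have hk : (24 : ℝ) * j ^ 2 = 24 * c ^ 2 / t ^ 2 := by
    rw [htdef]; field_simp
  have hKk : K < 24 * j ^ 2 := by nlinarith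
  have hx := hK (24 * j ^ 2) hKk (t ^ 8) (by rw [htdef]; exact witness_mem_window hc1 hj3)
  rw [hk, ddyk_witness ht, dyk_witness ht] at hx
  have hs := sqrt_dyk_witness_ge (c := c) ht
  rw [dyk_witness ht] at hs
  exact core ht hb hc1 hbc hC hs hx

/-- **C129 kill: Step 10 `Step_subsol` = (5.18) p.36 is FALSE** (instantiate at `C = b = 1`).
Class: false lemma (countermodel, functions grain). [cite: Nadirashvili2026, (5.18) p.36] -/
theorem not_Step_subsol : ¬ Literature.Claims.NS.Nadirashvili2026.Step_subsol := fun h =>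
  not_step_subsol_at one_pos zero_le_one (h 1 1 one_pos one_pos)

/-- The `deriv` spelling of Step 10 (skeleton rev 2, `Step_subsol_deriv`) is false as well, through
the skeleton's own `step_subsol_deriv_iff`. [cite: Nadirashvili2026, (5.18) p.36] -/
theorem not_Step_subsol_deriv : ¬ Literature.Claims.NS.Nadirashvili2026.Step_subsol_deriv :=
  fun h => not_Step_subsol (step_subsol_deriv_iff.mp h)

end Summit.NavierStokesRegularity.NavierStokesRegularity.Theorems.Nadirashvili2026

-- WHAT THIS IS NOT: not a claim about NS regularity or blow-up; not a claim about any author beyond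
-- the typed locator.
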